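import Summits.ValiantsHypothesis.ValiantsHypothesis.Theorems.LacunarySymmetroidMatrixDescartesPivotTwoDirectionsBlockLawII
import Summits.ValiantsHypothesis.ValiantsHypothesis.Theorems.LacunarySymmetroidMatrixDescartesCensusSignVariationsWindow
import Summits.ValiantsHypothesis.ValiantsHypothesis.Theorems.LacunarySymmetroidMatrixDescartesCensusFullAlternation

/-!
# `MatrixDescartes` census — THE BLOCK `(2,2)` LAW FOR EVERY EXPONENT CONFIGURATION: sign-separated two-direction `(2,4)₁`
# hard-cell pencils have `Z₊ ≤ 6 = 2K − 2` (chambers I/II by the kill-five theorems, everywhere else by a window count)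

HONEST FRAMING.  Object-search cell `pub-symmetroid`, seat `val-sym-mdr-p1` (generation 13); helper file `--supports` the crux item
stmt-ValiantsHypothesis-18050 (`Theses.LacunarySymmetroid.MatrixDescartes`, OPEN, on HOLD) with NO closure claim.  Completes the BLOCK
`(2,2)` LAW of val-sym-mdr-p1 g12 (`…PivotTwoDirectionsBlockLaw` / `…BlockLawII`: `Z₊ ≤ 6` in the two INTERLEAVING chambers I and II,
where the hard-cell nine-nomial alternates perfectly and Descartes allows `8`; memo BLOCKS.md §2: «every other configuration by
Descartes (paper)») by making the «paper» half kernel, uniformly and without a case analysis over the ≈ 25 remaining orders.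

SETTING (`det_block22`).  `F = X^e J + (c₁X^{p₁} + c₂X^{p₂}) uuᵀ + (c₃X^{q₁} + c₄X^{q₂}) vvᵀ`, `p₂ < p₁ < e < q₁ < q₂`, `cᵢ > 0`,
`u ∦ v`, both directions CORE (`m(J,u) < 0`, `m(J,v) < 0`), `det J` arbitrary.  `det F` is a nine-nomial: pivot-type degrees
`e+p₂ < e+p₁ < 2e < e+q₁ < e+q₂` (coefficients `c₂m(J,u)`, `c₁m(J,u)`, `det J`, `c₃m(J,v)`, `c₄m(J,v)`; the two END ones are negative and
never coincide with another degree) and pair degrees `pᵢ + qⱼ` (coefficients `cᵢcⱼΔ² ≥ 0`).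
* `nineNomial_le_six_of_gap`: if one of the four gaps between consecutive pivot-type degrees carries no pair degree, `Z₊ ≤ 6` — either a
  middle pivot-type coefficient (merged with a coinciding pair term) is `≥ 0`, leaving four negative coefficients with both ends negative
  (`Census.signVariations_two_ended_le`: `Var + 2 ≤ 8`), or all five are negative and the empty gap is a non-positive window with three
  negative degrees outside it (`Census.signVariations_window_two_ended`: `Var + 2 ≤ 2·3 + 2`);
* `gap_of_not_chamber` (linear arithmetic): outside the open chambers I (`q₁+p₁ < 2e`, `q₁+p₂ < e+p₁`, `2e < q₂+p₂ < q₁+e`) and II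
  (`q₁+p₂ < e+p₁ < q₂+p₂ < 2e < q₁+p₁`, `q₁+e < q₂+p₁`) some gap is empty;
* **`blockLaw_nineNomial_le_six`** / **`blockLaw_posRoots_le_six`** (matrix form): `Z₊ ≤ 6` for EVERY `p₂ < p₁ < e < q₁ < q₂` — chambers
  I/II by g12's `nineNomial_chamberI_le_six` / `nineNomial_chamberII_le_six`, the rest by the gap theorem.  Sharp:
  `…PivotTwoDirectionsBlockSix` (exactly `6`).  This closes the recorded BLOCK QUESTION of `…PivotTwoDirections` («two directions ⇒
  `Z₊ ≤ 2K − 2`?») at `(K_u, K_v) = (2,2)` in the sign-separated case; the `(2,3)` block and letters of one direction on both sides of the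
  pivot remain open (BLOCKS.md §4).
Nothing here bears on `MatrixDescartes` in its window, on `DoorA26` / `DoorA34`, registers / credences, or `VP ≠ VNP`.

[folklore] Descartes bookkeeping with the window lemma; tree lemmas named above.  No definitions, no named facts.
-/

-- `Summit.ValiantsHypothesis.ValiantsHypothesis.…` repeats a component by the D-0017 layout
-- (single-conjunct summit), which the `dupNamespace` linter flags; the name is mandated.
set_option linter.dupNamespace false

namespace Summit.ValiantsHypothesis.ValiantsHypothesis.Theorems.LacunarySymmetroidMatrixDescartes.Pivot.TwoDirections.BlockLawAll

open Polynomial Matrix Finset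
open scoped BigOperators

/-! ## 3. The sign-separated `(2,2)` nine-nomial: negative coefficients only at the five pivot-type degrees -/

/-- Coefficients of the nine-nomial `∑ᵢ C(cᵢ) X^{nᵢ}` on the degrees `(2e, e+p₁, e+p₂, e+q₁, e+q₂, p₁+q₁, p₂+q₁, p₁+q₂, p₂+q₂)`. -/
theorem coeff_nineNomial (e p₁ p₂ q₁ q₂ : ℕ) (cv : Fin 9 → ℝ) (m : ℕ) :
    (∑ i : Fin 9, Polynomial.C (cv i) * X ^ ((![2 * e, e + p₁, e + p₂, e + q₁, e + q₂, p₁ + q₁, p₂ + q₁, p₁ + q₂, p₂ + q₂] : Fin 9 → ℕ) i)).coeff m = ∑ i : Fin 9, (if m = (![2 * e, e + p₁, e + p₂, e + q₁, e + q₂, p₁ + q₁, p₂ + q₁, p₁ + q₂, p₂ + q₂] : Fin 9 → ℕ) i then cv i else 0) := by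
  rw [finsetSum_coeff]
  simp only [coeff_C_mul_X_pow]

/-- With non-negative PAIR coefficients (positions `5, …, 8`), a negative coefficient sits at a pivot-type degree. -/
theorem eq_pivotDegree_of_coeff_neg₉ (e p₁ p₂ q₁ q₂ : ℕ) (cv : Fin 9 → ℝ) (hpos : ∀ i : Fin 9, 5 ≤ (i : ℕ) → 0 ≤ cv i) (m : ℕ)
    (hm : (∑ i : Fin 9, Polynomial.C (cv i) * X ^ ((![2 * e, e + p₁, e + p₂, e + q₁, e + q₂, p₁ + q₁, p₂ + q₁, p₁ + q₂, p₂ + q₂] : Fin 9 → ℕ) i)).coeff m < 0) :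
    m = 2 * e ∨ m = e + p₁ ∨ m = e + p₂ ∨ m = e + q₁ ∨ m = e + q₂ := by
  rw [coeff_nineNomial] at hm
  by_contra hcon
  push Not at hcon
  obtain ⟨h1, h2, h3, h4, h5⟩ := hcon
  refine absurd hm (not_lt.mpr (Finset.sum_nonneg fun i _ => ?_))
  fin_cases i <;> (split_ifs with h) <;> first
      | exact le_rfl
      | exact absurd h h1 | exact absurd h h2 | exact absurd h h3 | exact absurd h h4 | exact absurd h h5
      | exact hpos _ (by simp)

/-- The nine-nomial has degree `e + q₂` and leading coefficient `c₄` (position `4`) when `p₂ < p₁ < e < q₁ < q₂` and that coefficient is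
non-zero. -/
theorem leadingCoeff_nineNomial (e p₁ p₂ q₁ q₂ : ℕ) (h21 : p₂ < p₁) (h1e : p₁ < e) (he1 : e < q₁) (h12 : q₁ < q₂)
    (cv : Fin 9 → ℝ) (h4 : cv 4 ≠ 0) : (∑ i : Fin 9, Polynomial.C (cv i) * X ^ ((![2 * e, e + p₁, e + p₂, e + q₁, e + q₂, p₁ + q₁, p₂ + q₁, p₁ + q₂, p₂ + q₂] : Fin 9 → ℕ) i)).leadingCoeff = cv 4 := by
  have hcoef : (∑ i : Fin 9, Polynomial.C (cv i) * X ^ ((![2 * e, e + p₁, e + p₂, e + q₁, e + q₂, p₁ + q₁, p₂ + q₁, p₁ + q₂, p₂ + q₂] : Fin 9 → ℕ) i)).coeff (e + q₂) = cv 4 := by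
    rw [coeff_nineNomial, Finset.sum_eq_single (4 : Fin 9)]
    · simp
    · intro i _ hi
      fin_cases i <;> simp at hi ⊢ <;> omega
    · simp
  have hle : (∑ i : Fin 9, Polynomial.C (cv i) * X ^ ((![2 * e, e + p₁, e + p₂, e + q₁, e + q₂, p₁ + q₁, p₂ + q₁, p₁ + q₂, p₂ + q₂] : Fin 9 → ℕ) i)).natDegree ≤ e + q₂ := by
    refine natDegree_sum_le_of_forall_le _ _ fun i _ => (natDegree_C_mul_X_pow_le _ _).trans ?_
    fin_cases i <;> simp <;> omega
  have hdeg : (∑ i : Fin 9, Polynomial.C (cv i) * X ^ ((![2 * e, e + p₁, e + p₂, e + q₁, e + q₂, p₁ + q₁, p₂ + q₁, p₁ + q₂, p₂ + q₂] : Fin 9 → ℕ) i)).natDegree = e + q₂ := natDegree_eq_of_le_of_coeff_ne_zero hle (by rw [hcoef]; exact h4)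
  change (∑ i : Fin 9, Polynomial.C (cv i) * X ^ ((![2 * e, e + p₁, e + p₂, e + q₁, e + q₂, p₁ + q₁, p₂ + q₁, p₁ + q₂, p₂ + q₂] : Fin 9 → ℕ) i)).coeff (∑ i : Fin 9, Polynomial.C (cv i) * X ^ ((![2 * e, e + p₁, e + p₂, e + q₁, e + q₂, p₁ + q₁, p₂ + q₁, p₁ + q₂, p₂ + q₂] : Fin 9 → ℕ) i)).natDegree = cv 4
  rw [hdeg, hcoef]

/-- The nine-nomial has trailing degree `e + p₂` and trailing coefficient `c₂` (position `2`) when `p₂ < p₁ < e < q₁ < q₂` and that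
coefficient is non-zero. -/
theorem trailingCoeff_nineNomial (e p₁ p₂ q₁ q₂ : ℕ) (h21 : p₂ < p₁) (h1e : p₁ < e) (he1 : e < q₁) (h12 : q₁ < q₂)
    (cv : Fin 9 → ℝ) (h2 : cv 2 ≠ 0) : (∑ i : Fin 9, Polynomial.C (cv i) * X ^ ((![2 * e, e + p₁, e + p₂, e + q₁, e + q₂, p₁ + q₁, p₂ + q₁, p₁ + q₂, p₂ + q₂] : Fin 9 → ℕ) i)).trailingCoeff = cv 2 := by
  have hcoef : (∑ i : Fin 9, Polynomial.C (cv i) * X ^ ((![2 * e, e + p₁, e + p₂, e + q₁, e + q₂, p₁ + q₁, p₂ + q₁, p₁ + q₂, p₂ + q₂] : Fin 9 → ℕ) i)).coeff (e + p₂) = cv 2 := by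
    rw [coeff_nineNomial, Finset.sum_eq_single (2 : Fin 9)]
    · simp
    · intro i _ hi
      fin_cases i <;> simp at hi ⊢ <;> omega
    · simp
  have hne : (∑ i : Fin 9, Polynomial.C (cv i) * X ^ ((![2 * e, e + p₁, e + p₂, e + q₁, e + q₂, p₁ + q₁, p₂ + q₁, p₁ + q₂, p₂ + q₂] : Fin 9 → ℕ) i)) ≠ 0 := fun h0 => by
    have := hcoef; rw [h0, coeff_zero] at this; exact h2 this.symm
  have hge : e + p₂ ≤ (∑ i : Fin 9, Polynomial.C (cv i) * X ^ ((![2 * e, e + p₁, e + p₂, e + q₁, e + q₂, p₁ + q₁, p₂ + q₁, p₁ + q₂, p₂ + q₂] : Fin 9 → ℕ) i)).natTrailingDegree := by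
    refine le_natTrailingDegree hne fun m hm => ?_
    rw [coeff_nineNomial]
    refine Finset.sum_eq_zero fun i _ => ?_
    rw [if_neg]
    fin_cases i <;> simp <;> omega
  have hle : (∑ i : Fin 9, Polynomial.C (cv i) * X ^ ((![2 * e, e + p₁, e + p₂, e + q₁, e + q₂, p₁ + q₁, p₂ + q₁, p₁ + q₂, p₂ + q₂] : Fin 9 → ℕ) i)).natTrailingDegree ≤ e + p₂ := natTrailingDegree_le_of_ne_zero (by rw [hcoef]; exact h2)
  change (∑ i : Fin 9, Polynomial.C (cv i) * X ^ ((![2 * e, e + p₁, e + p₂, e + q₁, e + q₂, p₁ + q₁, p₂ + q₁, p₁ + q₂, p₂ + q₂] : Fin 9 → ℕ) i)).coeff (∑ i : Fin 9, Polynomial.C (cv i) * X ^ ((![2 * e, e + p₁, e + p₂, e + q₁, e + q₂, p₁ + q₁, p₂ + q₁, p₁ + q₂, p₂ + q₂] : Fin 9 → ℕ) i)).natTrailingDegree = cv 2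
  rw [le_antisymm hle hge, hcoef]

/-- **THE BLOCK NINE-NOMIAL OUTSIDE THE INTERLEAVING CHAMBERS: `Z₊ ≤ 6`** (real-parameter form).  Degrees as in `det_block22`
(`p₂ < p₁ < e < q₁ < q₂`), non-negative pair coefficients, END coefficients (at `e + p₂` and `e + q₂`) negative, the other three
pivot-type coefficients arbitrary; if one of the four gaps between consecutive pivot-type degrees `e+p₂ < e+p₁ < 2e < e+q₁ < e+q₂`
carries no pair degree, then at most SIX positive roots: either a middle pivot-type coefficient is `≥ 0` (four negative coefficients,
both ends negative: two-ended budget `Var + 2 ≤ 8`) or all five are negative and the empty gap is a non-positive window with three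
negative degrees outside (`Census.signVariations_window_two_ended`: `Var + 2 ≤ 2·3 + 2`). -/
theorem nineNomial_le_six_of_gap (e p₁ p₂ q₁ q₂ : ℕ) (h21 : p₂ < p₁) (h1e : p₁ < e) (he1 : e < q₁) (h12 : q₁ < q₂)
    (hgap : (e + p₁ ≤ p₂ + q₁)
      ∨ (2 * e ≤ p₁ + q₁ ∧ (p₂ + q₁ ≤ e + p₁ ∨ 2 * e ≤ p₂ + q₁) ∧ (p₂ + q₂ ≤ e + p₁ ∨ 2 * e ≤ p₂ + q₂))
      ∨ (p₁ + q₁ ≤ 2 * e ∧ (p₁ + q₂ ≤ 2 * e ∨ e + q₁ ≤ p₁ + q₂) ∧ (p₂ + q₂ ≤ 2 * e ∨ e + q₁ ≤ p₂ + q₂))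
      ∨ (p₁ + q₂ ≤ e + q₁))
    (cv : Fin 9 → ℝ) (hpos : ∀ i : Fin 9, 5 ≤ (i : ℕ) → 0 ≤ cv i) (h2 : cv 2 < 0) (h4 : cv 4 < 0) :
    ((∑ i : Fin 9, Polynomial.C (cv i) * X ^ ((![2 * e, e + p₁, e + p₂, e + q₁, e + q₂, p₁ + q₁, p₂ + q₁, p₁ + q₂, p₂ + q₂] : Fin 9 → ℕ) i)).roots.toFinset.filter (fun t => 0 < t)).card ≤ 6 := by
  classical
  set f := (∑ i : Fin 9, Polynomial.C (cv i) * X ^ ((![2 * e, e + p₁, e + p₂, e + q₁, e + q₂, p₁ + q₁, p₂ + q₁, p₁ + q₂, p₂ + q₂] : Fin 9 → ℕ) i)) with hf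
  have hlead : f.leadingCoeff < 0 := by rw [hf, leadingCoeff_nineNomial e p₁ p₂ q₁ q₂ h21 h1e he1 h12 cv h4.ne]; exact h4
  have htrail : f.trailingCoeff < 0 := by rw [hf, trailingCoeff_nineNomial e p₁ p₂ q₁ q₂ h21 h1e he1 h12 cv h2.ne]; exact h2
  have hneg : ∀ m, f.coeff m < 0 → m = 2 * e ∨ m = e + p₁ ∨ m = e + p₂ ∨ m = e + q₁ ∨ m = e + q₂ :=
    fun m hm => eq_pivotDegree_of_coeff_neg₉ e p₁ p₂ q₁ q₂ cv hpos m hm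
  have hbudget := Census.signVariations_two_ended_le f
  rw [if_pos hlead, if_pos htrail] at hbudget
  refine (Census.card_posRoots_le_signVariations f).trans ?_
  -- Step 1: a middle pivot-type coefficient is non-negative ⇒ at most four negative coefficients
  have step1 : ∀ m₀, (m₀ = 2 * e ∨ m₀ = e + p₁ ∨ m₀ = e + q₁) → 0 ≤ f.coeff m₀ → f.signVariations ≤ 6 := by
    intro m₀ hm₀ h0
    have hsub : TwoDescartes.negSupp f ⊆ ({2 * e, e + p₁, e + p₂, e + q₁, e + q₂} : Finset ℕ).erase m₀ := by
      intro n hn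
      simp only [TwoDescartes.negSupp, Finset.mem_filter] at hn
      have h1 := hneg n hn.2
      refine Finset.mem_erase.mpr ⟨fun h => ?_, ?_⟩
      · rw [h] at hn; exact absurd hn.2 (not_lt.mpr h0)
      · simp only [Finset.mem_insert, Finset.mem_singleton]; omega
    have hm₀S : m₀ ∈ ({2 * e, e + p₁, e + p₂, e + q₁, e + q₂} : Finset ℕ) := by
      simp only [Finset.mem_insert, Finset.mem_singleton]; omega
    have hc := Finset.card_le_card hsub
    rw [Finset.card_erase_of_mem hm₀S] at hc
    have : ({2 * e, e + p₁, e + p₂, e + q₁, e + q₂} : Finset ℕ).card ≤ 5 := Finset.card_le_five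
    omega
  by_cases hc : 0 ≤ f.coeff (2 * e)
  · exact step1 _ (by omega) hc
  by_cases hb : 0 ≤ f.coeff (e + p₁)
  · exact step1 _ (by omega) hb
  by_cases hd : 0 ≤ f.coeff (e + q₁)
  · exact step1 _ (by omega) hd
  push Not at hc hb hd
  -- all five negative: the values at the pure end degrees
  have hA : f.coeff (e + p₂) < 0 := by
    have h : f.coeff (e + p₂) = cv 2 := by
      rw [hf, coeff_nineNomial, Finset.sum_eq_single (2 : Fin 9)]
      · simp
      · intro i _ hi
        fin_cases i <;> simp at hi ⊢ <;> omega
      · simp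
    rw [h]; exact h2
  have hE : f.coeff (e + q₂) < 0 := by
    have h : f.coeff (e + q₂) = cv 4 := by
      rw [hf, coeff_nineNomial, Finset.sum_eq_single (4 : Fin 9)]
      · simp
      · intro i _ hi
        fin_cases i <;> simp at hi ⊢ <;> omega
      · simp
    rw [h]; exact h4
  have hzero : ∀ m, (∀ i : Fin 9, m ≠ (![2 * e, e + p₁, e + p₂, e + q₁, e + q₂, p₁ + q₁, p₂ + q₁, p₁ + q₂, p₂ + q₂] : Fin 9 → ℕ) i) → f.coeff m ≤ 0 := by
    intro m hm
    rw [hf, coeff_nineNomial]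
    refine Finset.sum_nonpos fun i _ => ?_
    rw [if_neg (hm i)]
  rcases hgap with g | g | g | g
  · have hw := Census.signVariations_window_two_ended f (e + p₂) (e + p₁) (by omega) (fun m hx hy => by
      rcases Nat.eq_or_lt_of_le hx with h | h
      · rw [← h]; exact hA.le
      rcases Nat.eq_or_lt_of_le hy with h' | h'
      · rw [h']; exact hb.le
      exact hzero m (fun i => by fin_cases i <;> simp <;> omega)) {2 * e, e + q₁, e + q₂}
      (fun m hm hout => by have := hneg m hm; simp only [Finset.mem_insert, Finset.mem_singleton]; omega)
    rw [if_pos hlead, if_pos htrail] at hw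
    have : ({2 * e, e + q₁, e + q₂} : Finset ℕ).card ≤ 3 := Finset.card_le_three
    omega
  · have hw := Census.signVariations_window_two_ended f (e + p₁) (2 * e) (by omega) (fun m hx hy => by
      rcases Nat.eq_or_lt_of_le hx with h | h
      · rw [← h]; exact hb.le
      rcases Nat.eq_or_lt_of_le hy with h' | h'
      · rw [h']; exact hc.le
      exact hzero m (fun i => by fin_cases i <;> simp <;> omega)) {e + p₂, e + q₁, e + q₂}
      (fun m hm hout => by have := hneg m hm; simp only [Finset.mem_insert, Finset.mem_singleton]; omega)
    rw [if_pos hlead, if_pos htrail] at hw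
    have : ({e + p₂, e + q₁, e + q₂} : Finset ℕ).card ≤ 3 := Finset.card_le_three
    omega
  · have hw := Census.signVariations_window_two_ended f (2 * e) (e + q₁) (by omega) (fun m hx hy => by
      rcases Nat.eq_or_lt_of_le hx with h | h
      · rw [← h]; exact hc.le
      rcases Nat.eq_or_lt_of_le hy with h' | h'
      · rw [h']; exact hd.le
      exact hzero m (fun i => by fin_cases i <;> simp <;> omega)) {e + p₂, e + p₁, e + q₂}
      (fun m hm hout => by have := hneg m hm; simp only [Finset.mem_insert, Finset.mem_singleton]; omega)
    rw [if_pos hlead, if_pos htrail] at hw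
    have : ({e + p₂, e + p₁, e + q₂} : Finset ℕ).card ≤ 3 := Finset.card_le_three
    omega
  · have hw := Census.signVariations_window_two_ended f (e + q₁) (e + q₂) (by omega) (fun m hx hy => by
      rcases Nat.eq_or_lt_of_le hx with h | h
      · rw [← h]; exact hd.le
      rcases Nat.eq_or_lt_of_le hy with h' | h'
      · rw [h']; exact hE.le
      exact hzero m (fun i => by fin_cases i <;> simp <;> omega)) {2 * e, e + p₂, e + p₁}
      (fun m hm hout => by have := hneg m hm; simp only [Finset.mem_insert, Finset.mem_singleton]; omega)
    rw [if_pos hlead, if_pos htrail] at hw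
    have : ({2 * e, e + p₂, e + p₁} : Finset ℕ).card ≤ 3 := Finset.card_le_three
    omega

/-- **Outside chambers I and II one of the four gaps is empty** (the nine-nomial analogue of the eleven-nomial fact: perfect
interleaving of the five pivot-type degrees with the four pair degrees happens in exactly the two chambers of `…BlockLaw` /
`…BlockLawII`). [linear arithmetic] -/
theorem gap_of_not_chamber (e p₁ p₂ q₁ q₂ : ℕ)
    (hI : ¬ (q₁ + p₁ < 2 * e ∧ q₁ + p₂ < e + p₁ ∧ 2 * e < q₂ + p₂ ∧ q₂ + p₂ < q₁ + e))
    (hII : ¬ (2 * e < q₁ + p₁ ∧ q₁ + p₂ < e + p₁ ∧ e + p₁ < q₂ + p₂ ∧ q₁ + e < q₂ + p₁ ∧ q₂ + p₂ < 2 * e)) :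
    (e + p₁ ≤ p₂ + q₁)
      ∨ (2 * e ≤ p₁ + q₁ ∧ (p₂ + q₁ ≤ e + p₁ ∨ 2 * e ≤ p₂ + q₁) ∧ (p₂ + q₂ ≤ e + p₁ ∨ 2 * e ≤ p₂ + q₂))
      ∨ (p₁ + q₁ ≤ 2 * e ∧ (p₁ + q₂ ≤ 2 * e ∨ e + q₁ ≤ p₁ + q₂) ∧ (p₂ + q₂ ≤ 2 * e ∨ e + q₁ ≤ p₂ + q₂))
      ∨ (p₁ + q₂ ≤ e + q₁) := by
  omega

/-- **THE BLOCK `(2,2)` LAW (real-parameter form): `Z₊ ≤ 6 = 2K − 2` for EVERY exponent configuration.**  The hard-cell nine-nomial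
of `det_block22` — `u`-weights `c₁, c₂ > 0` (exponents `p₁ > p₂` below the pivot), `v`-weights `c₃, c₄ > 0` (exponents `q₁ < q₂` above),
both pairings negative (`mu, mv < 0`), squared direction discriminant `Δ2 > 0`, pivot determinant `dJ` ARBITRARY — has at most six
positive roots: chambers I and II by the kill-five theorems `nineNomial_chamberI_le_six` / `nineNomial_chamberII_le_six`
(val-sym-mdr-p1 g12), everywhere else by `nineNomial_le_six_of_gap`. [this file] -/
theorem blockLaw_nineNomial_le_six (e p₁ p₂ q₁ q₂ : ℕ) (h21 : p₂ < p₁) (h1e : p₁ < e) (he1 : e < q₁) (h12 : q₁ < q₂)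
    (dJ mu mv Δ2 c₁ c₂ c₃ c₄ : ℝ) (hc₁ : 0 < c₁) (hc₂ : 0 < c₂) (hc₃ : 0 < c₃) (hc₄ : 0 < c₄) (hmu : mu < 0) (hmv : mv < 0)
    (hΔ2p : 0 < Δ2) :
    ((∑ i : Fin 9, Polynomial.C ((![dJ, c₁ * mu, c₂ * mu, c₃ * mv, c₄ * mv, c₁ * c₃ * Δ2, c₂ * c₃ * Δ2, c₁ * c₄ * Δ2, c₂ * c₄ * Δ2] : Fin 9 → ℝ) i) * X ^ ((![2 * e, e + p₁, e + p₂, e + q₁, e + q₂, p₁ + q₁, p₂ + q₁, p₁ + q₂, p₂ + q₂] : Fin 9 → ℕ) i)).roots.toFinset.filter (fun t => 0 < t)).card ≤ 6 := by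
  by_cases hI : q₁ + p₁ < 2 * e ∧ q₁ + p₂ < e + p₁ ∧ 2 * e < q₂ + p₂ ∧ q₂ + p₂ < q₁ + e
  · exact BlockLaw.nineNomial_chamberI_le_six e p₁ p₂ q₁ q₂ h21 h1e he1 h12 hI.1 hI.2.1 hI.2.2.1 hI.2.2.2 dJ mu mv Δ2 c₁ c₂ c₃ c₄
      hc₁ hc₂ hc₄ hmu hΔ2p
  by_cases hII : 2 * e < q₁ + p₁ ∧ q₁ + p₂ < e + p₁ ∧ e + p₁ < q₂ + p₂ ∧ q₁ + e < q₂ + p₁ ∧ q₂ + p₂ < 2 * e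
  · exact BlockLaw.nineNomial_chamberII_le_six e p₁ p₂ q₁ q₂ h21 h1e he1 h12 hII.1 hII.2.1 hII.2.2.1 hII.2.2.2.1 hII.2.2.2.2 dJ mu mv
      Δ2 c₁ c₂ c₃ c₄ hc₂ hc₃ hc₄ hmv hΔ2p
  exact nineNomial_le_six_of_gap e p₁ p₂ q₁ q₂ h21 h1e he1 h12 (gap_of_not_chamber e p₁ p₂ q₁ q₂ hI hII) _
    (fun i hi => by fin_cases i <;> simp at hi ⊢ <;> positivity)
    (by simp only [Fin.isValue, Matrix.cons_val]; exact mul_neg_of_pos_of_neg hc₂ hmu)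
    (by simp only [Fin.isValue, Matrix.cons_val]; exact mul_neg_of_pos_of_neg hc₄ hmv)

/-- **THE BLOCK `(2,2)` LAW (matrix form): sign-separated two-direction `(2,4)₁` hard-cell pencils have `Z₊ ≤ 6 = 2K − 2`.**
`F = X^e J + (c₁X^{p₁} + c₂X^{p₂}) uuᵀ + (c₃X^{q₁} + c₄X^{q₂}) vvᵀ` with `p₂ < p₁ < e < q₁ < q₂` (two `u`-letters below the pivot, two
`v`-letters above), `cᵢ > 0`, `u ∦ v`, BOTH directions core (`m(J,u) < 0`, `m(J,v) < 0`), `J` otherwise ARBITRARY (any `det J`): at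
most SIX distinct positive determinant roots — for every exponent configuration (Descartes allows `8` in the two interleaving chambers;
`…PivotTwoDirectionsBlockSix` attains `6`).  This closes the recorded BLOCK QUESTION of `…PivotTwoDirections` at `(K_u, K_v) = (2,2)`
in the sign-separated case. [this file + `…BlockLaw`, `…BlockLawII`] -/
theorem blockLaw_posRoots_le_six (e p₁ p₂ q₁ q₂ : ℕ) (h21 : p₂ < p₁) (h1e : p₁ < e) (he1 : e < q₁) (h12 : q₁ < q₂)
    (J : Matrix (Fin 2) (Fin 2) ℝ) (u v : Fin 2 → ℝ) (c₁ c₂ c₃ c₄ : ℝ) (hc₁ : 0 < c₁) (hc₂ : 0 < c₂) (hc₃ : 0 < c₃) (hc₄ : 0 < c₄)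
    (hmu : J 0 0 * u 1 ^ 2 + J 1 1 * u 0 ^ 2 - (J 0 1 + J 1 0) * (u 0 * u 1) < 0)
    (hmv : J 0 0 * v 1 ^ 2 + J 1 1 * v 0 ^ 2 - (J 0 1 + J 1 0) * (v 0 * v 1) < 0) (hΔ : u 0 * v 1 - u 1 * v 0 ≠ 0) :
    ((Matrix.det (((X : ℝ[X]) ^ e) • J.map Polynomial.C
        + (Polynomial.C c₁ * X ^ p₁ + Polynomial.C c₂ * X ^ p₂) • (vecMulVec u u).map Polynomial.C
        + (Polynomial.C c₃ * X ^ q₁ + Polynomial.C c₄ * X ^ q₂) • (vecMulVec v v).map Polynomial.C)).roots.toFinset.filter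
        (fun t => 0 < t)).card ≤ 6 := by
  rw [BlockLaw.det_block22]
  exact blockLaw_nineNomial_le_six e p₁ p₂ q₁ q₂ h21 h1e he1 h12 J.det _ _ _ c₁ c₂ c₃ c₄ hc₁ hc₂ hc₃ hc₄ hmu hmv (by positivity)

end Summit.ValiantsHypothesis.ValiantsHypothesis.Theorems.LacunarySymmetroidMatrixDescartes.Pivot.TwoDirections.BlockLawAll
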